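import Mathlib
import HarnessLib
import Literature.Probability.MarkovChains.MetropolisHastings

/-!
# The chain watched on a subset keeps the restricted invariant law (censored / embedded chain)

HONEST FRAMING: exact (Metropolis-corrected) sampling algorithms for lattice gauge theory;
figures of merit are autocorrelation/cost numbers at stated couplings and volumes; no
continuum-physics claim.

Venture `LatticeQCDFlow` (cell pub-lqcd), topic `Exactness`; FANOUT row 13 (`eng-snf`, GEN-8).
NEW WORK of the cell (elementary finite sums), not a published result; nothing is cited as a fact.
The construction is classical and named only: the chain "watched on `A`" / censored / embedded
chain and its kernel through the fundamental matrix of the complement (Kemeny–Snell, *Finite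
Markov Chains* (1960) ch. III, VI; Meyn–Tweedie, *Markov Chains and Stochastic Stability* §10.4
"process on A").

WHY (engine dictionary, `latflow-snf` ≥ 0.1.9 `snf.ncmc`): the `ncmc-metropolis` sampler lives on
`Bool × X` and reports target expectations as plain averages over the samples taken WHILE AT THE
TARGET LEVEL (`ncmc.target_means`, `ncmc.censored_target_chain`), i.e. over the chain watched on
`A = {target} × X`.  `Exactness/NCMCExpandedEnsemble.lean` gives the invariant joint weight and its
restriction to `A` (`ncmc_conditional_target`: ∝ the target Gibbs law); THIS file is the missing
algebraic step: the censored kernel leaves the RESTRICTION of any invariant weight invariant.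

## Content (finite `X`, kernel `P`, weight `π` with `IsStationary π P`, a set `A : Finset X`, `B = Aᶜ`)

* hypotheses `hN₁` / `hN₂` — `N` is a fundamental kernel of the block `B`: the resolvent identities
  `N = 1 + P_BB N` (`hN₁`) and `N = 1 + N P_BB` (`hN₂`) on `B × B` (satisfied by `N = Σ_k P_BB^k`, the
  expected numbers of visits before leaving `B`, whenever the chain leaves `B` almost surely —
  taken here as HYPOTHESES, stated inline, no definition; the probabilistic identification of
  `censoredKernel` with the law of successive visits to `A` (strong Markov property) is not
  formalised, only its algebra);
* `censoredKernel P N A x z = P x z + Σ_{y ∈ B} P x y Σ_{w ∈ B} N y w P w z` — one step inside `A`,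
  or an excursion through `B` of any length re-entering `A` at `z`;
* `sum_A_add_sum_compl_stationary` — block form of stationarity;
* **`pi_compl_eq_entrance`** — `π w = Σ_{y ∈ B} (Σ_{x ∈ A} π x P x y) N y w` for `w ∈ B`: the
  invariant mass on the complement is the `A`-exit flow propagated by the fundamental kernel
  (first resolvent identity only);
* **`censoredKernel_stationaryOn`** — `Σ_{x ∈ A} π x K x z = π z` for every `z ∈ A`: THE RESTRICTION
  `π|_A` IS INVARIANT for the censored kernel (so averages along the watched chain estimate
  `π(· | A)`-expectations — for the NCMC sampler: target expectations);
* `censoredKernel_rowsum` — `Σ_{z ∈ A} K x z = 1` for `x ∈ A` when `P` has unit row sums (second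
  resolvent identity), `censoredKernel_nonneg` — `K ≥ 0` for `P, N ≥ 0`: a Markov kernel on `A`;
  `censoredKernel_isStationary_restrict` — the same invariance as an `IsStationary` statement on `X`
  for the weight and kernel extended by zero off `A`.
-/

namespace Summit.Ventures.LatticeQCDFlow.Exactness

open Finset
open Literature.Probability.MarkovChains

variable {X : Type*} [Fintype X] [DecidableEq X]

/-- The CENSORED kernel on `A` (the chain watched on `A`): a direct step `x → z`, or an exit to
`y ∈ B`, an excursion inside `B` accounted by the fundamental kernel `N`, and re-entry at `z`. -/
noncomputable def censoredKernel (P N : X → X → ℝ) (A : Finset X) (x z : X) : ℝ :=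
  P x z + ∑ y ∈ Aᶜ, P x y * ∑ w ∈ Aᶜ, N y w * P w z

/-- Block form of stationarity: `Σ_{x ∈ A} π x P x w + Σ_{y ∈ Aᶜ} π y P y w = π w`. -/
theorem sum_A_add_sum_compl_stationary {π : X → ℝ} {P : X → X → ℝ} (hst : IsStationary π P)
    (A : Finset X) (w : X) :
    ∑ x ∈ A, π x * P x w + ∑ y ∈ Aᶜ, π y * P y w = π w := by
  rw [sum_add_sum_compl]
  exact hst w

/-- **The invariant mass on the complement is the exit flow from `A` propagated by `N`:**
`π w = Σ_{y ∈ B} (Σ_{x ∈ A} π x P x y) · N y w` for every `w ∈ B` (stationarity + the first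
resolvent identity). -/
theorem pi_compl_eq_entrance {π : X → ℝ} {P N : X → X → ℝ} (hst : IsStationary π P)
    {A : Finset X}
    (hN₁ : ∀ y ∈ Aᶜ, ∀ w ∈ Aᶜ, N y w = (if y = w then 1 else 0) + ∑ v ∈ Aᶜ, P y v * N v w)
    {w : X} (hw : w ∈ Aᶜ) :
    π w = ∑ y ∈ Aᶜ, (∑ x ∈ A, π x * P x y) * N y w := by
  -- replace the exit flow by `π y − Σ_{v ∈ B} π v P v y`
  have hflow : ∀ y, ∑ x ∈ A, π x * P x y = π y - ∑ v ∈ Aᶜ, π v * P v y := fun y => by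
    have := sum_A_add_sum_compl_stationary hst A y
    linarith
  simp_rw [hflow, sub_mul, sum_sub_distrib]
  -- Σ_y (Σ_v π v P v y) N y w = Σ_v π v (N v w − [v = w]) by the first resolvent identity
  have hres : ∑ y ∈ Aᶜ, (∑ v ∈ Aᶜ, π v * P v y) * N y w =
      ∑ v ∈ Aᶜ, π v * N v w - π w := by
    calc ∑ y ∈ Aᶜ, (∑ v ∈ Aᶜ, π v * P v y) * N y w
        = ∑ v ∈ Aᶜ, π v * ∑ y ∈ Aᶜ, P v y * N y w := by
          simp_rw [sum_mul, mul_sum]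
          rw [sum_comm]
          exact sum_congr rfl fun v _ => sum_congr rfl fun y _ => by ring
      _ = ∑ v ∈ Aᶜ, π v * (N v w - if v = w then 1 else 0) := by
          refine sum_congr rfl fun v hv => ?_
          rw [hN₁ v hv w hw]
          ring
      _ = ∑ v ∈ Aᶜ, π v * N v w - ∑ v ∈ Aᶜ, π v * (if v = w then 1 else 0) := by
          rw [← sum_sub_distrib]
          exact sum_congr rfl fun v _ => by ring
      _ = ∑ v ∈ Aᶜ, π v * N v w - π w := by
          simp_rw [mul_ite, mul_one, mul_zero]
          rw [sum_ite_eq' Aᶜ w, if_pos hw]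
  rw [hres]
  ring

/-- **The restriction of an invariant weight is invariant for the censored kernel:**
`Σ_{x ∈ A} π x · K x z = π z` for every `z ∈ A`.  (For the `ncmc-metropolis` sampler: the chain
watched on the target level keeps `ncmcWeight c S` restricted to that level — ∝ the target Gibbs law
by `ncmc_conditional_target` — invariant, which is what averaging over target-level samples uses.) -/
theorem censoredKernel_stationaryOn {π : X → ℝ} {P N : X → X → ℝ} (hst : IsStationary π P)
    {A : Finset X}
    (hN₁ : ∀ y ∈ Aᶜ, ∀ w ∈ Aᶜ, N y w = (if y = w then 1 else 0) + ∑ v ∈ Aᶜ, P y v * N v w)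
    {z : X} (_hz : z ∈ A) :
    ∑ x ∈ A, π x * censoredKernel P N A x z = π z := by
  unfold censoredKernel
  simp_rw [mul_add, sum_add_distrib]
  -- the excursion term equals Σ_{w ∈ B} π w P w z
  have hexc : ∑ x ∈ A, π x * ∑ y ∈ Aᶜ, P x y * ∑ w ∈ Aᶜ, N y w * P w z =
      ∑ w ∈ Aᶜ, π w * P w z := by
    have hL : ∑ x ∈ A, π x * ∑ y ∈ Aᶜ, P x y * ∑ w ∈ Aᶜ, N y w * P w z =
        ∑ x ∈ A, ∑ y ∈ Aᶜ, ∑ w ∈ Aᶜ, π x * P x y * N y w * P w z := by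
      refine sum_congr rfl fun x _ => ?_
      rw [mul_sum]
      refine sum_congr rfl fun y _ => ?_
      rw [← mul_assoc, mul_sum]
      exact sum_congr rfl fun w _ => by ring
    have hR : ∑ w ∈ Aᶜ, (∑ y ∈ Aᶜ, (∑ x ∈ A, π x * P x y) * N y w) * P w z =
        ∑ w ∈ Aᶜ, ∑ y ∈ Aᶜ, ∑ x ∈ A, π x * P x y * N y w * P w z := by
      refine sum_congr rfl fun w _ => ?_
      rw [sum_mul]
      refine sum_congr rfl fun y _ => ?_
      rw [sum_mul, sum_mul]
    have hswap : ∑ x ∈ A, ∑ y ∈ Aᶜ, ∑ w ∈ Aᶜ, π x * P x y * N y w * P w z =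
        ∑ w ∈ Aᶜ, ∑ y ∈ Aᶜ, ∑ x ∈ A, π x * P x y * N y w * P w z := by
      rw [sum_comm]
      rw [sum_congr rfl fun y _ => sum_comm]
      rw [sum_comm]
    calc ∑ x ∈ A, π x * ∑ y ∈ Aᶜ, P x y * ∑ w ∈ Aᶜ, N y w * P w z
        = ∑ w ∈ Aᶜ, (∑ y ∈ Aᶜ, (∑ x ∈ A, π x * P x y) * N y w) * P w z := by rw [hL, hswap, ← hR]
      _ = ∑ w ∈ Aᶜ, π w * P w z :=
          sum_congr rfl fun w hw => by rw [← pi_compl_eq_entrance hst hN₁ hw]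
  rw [hexc]
  exact sum_A_add_sum_compl_stationary hst A z

/-- The censored kernel has unit row sums on `A` when `P` has (second resolvent identity). -/
theorem censoredKernel_rowsum {P N : X → X → ℝ} (hP : ∀ x, ∑ z, P x z = 1) {A : Finset X}
    (hN₂ : ∀ y ∈ Aᶜ, ∀ w ∈ Aᶜ, N y w = (if y = w then 1 else 0) + ∑ v ∈ Aᶜ, N y v * P v w)
    {x : X} (_hx : x ∈ A) :
    ∑ z ∈ A, censoredKernel P N A x z = 1 := by
  unfold censoredKernel
  rw [sum_add_distrib]
  -- Σ_{z ∈ A} P w z = 1 − Σ_{z ∈ B} P w z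
  have hA : ∀ w, ∑ z ∈ A, P w z = 1 - ∑ z ∈ Aᶜ, P w z := fun w => by
    have := sum_add_sum_compl A (fun z => P w z)
    rw [hP w] at this
    linarith
  -- Σ_{w ∈ B} N y w (1 − Σ_{z∈B} P w z) = 1 for y ∈ B
  have hN1 : ∀ y ∈ Aᶜ, ∑ w ∈ Aᶜ, N y w * (1 - ∑ z ∈ Aᶜ, P w z) = 1 := fun y hy => by
    have hcol : ∑ z ∈ Aᶜ, ∑ w ∈ Aᶜ, N y w * P w z = ∑ z ∈ Aᶜ, (N y z - if y = z then 1 else 0) :=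
      sum_congr rfl fun z hz => by rw [hN₂ y hy z hz]; ring
    calc ∑ w ∈ Aᶜ, N y w * (1 - ∑ z ∈ Aᶜ, P w z)
        = ∑ w ∈ Aᶜ, N y w - ∑ z ∈ Aᶜ, ∑ w ∈ Aᶜ, N y w * P w z := by
          rw [sum_comm, ← sum_sub_distrib]
          exact sum_congr rfl fun w _ => by rw [mul_sub, mul_one, mul_sum]
      _ = ∑ w ∈ Aᶜ, N y w - ∑ z ∈ Aᶜ, (N y z - if y = z then 1 else 0) := by rw [hcol]
      _ = 1 := by
          rw [sum_sub_distrib, sum_ite_eq Aᶜ y, if_pos hy]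
          ring
  have h2 : ∑ z ∈ A, ∑ y ∈ Aᶜ, P x y * ∑ w ∈ Aᶜ, N y w * P w z = ∑ y ∈ Aᶜ, P x y := by
    rw [sum_comm]
    refine sum_congr rfl fun y hy => ?_
    calc ∑ z ∈ A, P x y * ∑ w ∈ Aᶜ, N y w * P w z
        = P x y * ∑ w ∈ Aᶜ, N y w * ∑ z ∈ A, P w z := by
          rw [← mul_sum]
          congr 1
          rw [sum_comm]
          exact sum_congr rfl fun w _ => by rw [mul_sum]
      _ = P x y * 1 := by
          congr 1
          rw [← hN1 y hy]
          exact sum_congr rfl fun w _ => by rw [hA w]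
      _ = P x y := mul_one _
  rw [h2, hA x]
  ring

/-- The censored kernel is non-negative for non-negative `P`, `N`. -/
theorem censoredKernel_nonneg {P N : X → X → ℝ} (hP : ∀ x y, 0 ≤ P x y) (hN : ∀ x y, 0 ≤ N x y)
    (A : Finset X) (x z : X) : 0 ≤ censoredKernel P N A x z :=
  add_nonneg (hP x z) (sum_nonneg fun y _ => mul_nonneg (hP x y)
    (sum_nonneg fun w _ => mul_nonneg (hN y w) (hP w z)))

/-- Hence the censored kernel is `π|_A`-stationary in the tree's sense for the weight restricted to
`A` (zero off `A`), as a kernel on all of `X` restricted by indicators: for every `z`,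
`Σ_x (1_A π) x · (1_A×A K) x z = (1_A π) z`. -/
theorem censoredKernel_isStationary_restrict {π : X → ℝ} {P N : X → X → ℝ} (hst : IsStationary π P)
    {A : Finset X}
    (hN₁ : ∀ y ∈ Aᶜ, ∀ w ∈ Aᶜ, N y w = (if y = w then 1 else 0) + ∑ v ∈ Aᶜ, P y v * N v w) :
    IsStationary (fun x => if x ∈ A then π x else 0)
      (fun x z => if x ∈ A ∧ z ∈ A then censoredKernel P N A x z else 0) := by
  intro z
  dsimp only
  by_cases hz : z ∈ A
  · rw [if_pos hz, ← censoredKernel_stationaryOn hst hN₁ hz, ← sum_filter_add_sum_filter_not univ (· ∈ A)]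
    have h1 : ∑ x ∈ univ.filter (· ∈ A), (if x ∈ A then π x else 0) *
        (if x ∈ A ∧ z ∈ A then censoredKernel P N A x z else 0) =
        ∑ x ∈ A, π x * censoredKernel P N A x z := by
      rw [show univ.filter (· ∈ A) = A from by ext; simp]
      exact sum_congr rfl fun x hx => by rw [if_pos hx, if_pos ⟨hx, hz⟩]
    have h2 : ∑ x ∈ univ.filter (fun x => ¬x ∈ A), (if x ∈ A then π x else 0) *
        (if x ∈ A ∧ z ∈ A then censoredKernel P N A x z else 0) = 0 :=
      sum_eq_zero fun x hx => by
        rw [mem_filter] at hx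
        rw [if_neg hx.2, zero_mul]
    rw [h1, h2, add_zero]
  · rw [if_neg hz]
    exact sum_eq_zero fun x _ => by simp [hz]

end Summit.Ventures.LatticeQCDFlow.Exactness
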